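import Mathlib
import Summits.Ventures.HodgeRepro2.GaloisSextic
import Summits.Ventures.HodgeRepro2.SexticGalois
import Summits.Ventures.HodgeRepro2.Existence
import Summits.Ventures.HodgeRepro2.Instance

/-!
# CyclotomicSeven — a sextic Galois CM field exists: `ℚ(ζ₇)`

Closes the honest-scope item «the existence of a sextic Galois CM field (all degree-6 statements are
conditional on `[IsGalois ℚ K]`, `[IsCMField K]`, `finrank ℚ K = 6`)» of `route/LEAN-ANNEX-p1.md` §9.8:
the seventh cyclotomic field `K7 = CyclotomicField 7 ℚ` is a number field of degree `φ(7) = 6`, Galois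
(abelian) over `ℚ` and CM (Mathlib: `IsCyclotomicExtension.isGalois`, `IsCyclotomicExtension.Rat.isCMField`,
`IsCyclotomicExtension.finrank` + `Polynomial.cyclotomic.irreducible_rat`). Every degree-6 statement of
`GaloisSextic.lean` / `SexticGalois.lean` / `Existence.lean` therefore holds UNCONDITIONALLY for `K7`
(`isCyclic_gal_K7`, `nonempty_mulEquiv_zmod_six_K7`, `exists_isWeilFace_K7`,
`range_inverseType_parityTetrahedron_K7`, `card_nonPrimitive_parityTetrahedron_K7`, `exists_thm81Data_K7`).

General facts proved on the way (any CM number field `K`): the complement of a CM type is its conjugate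
(`compl_eq_image_conjugate`), `2 · |Φ| = [K : ℚ]` for every CM type `Φ` (`two_mul_ncard_cmType`), and a CM
field of degree 6 carries a CM type indexed by `Fin 3`, i.e. the data `τ : Fin 3 → (K →+* ℂ)` of
`parityTetrahedron` (`exists_cmType_triple`, `exists_isWeilFace`).

Technical note: `CyclotomicField 7 ℚ` carries two `ℚ`-algebra structures (the splitting-field one and
`DivisionRing.toRatAlgebra`); they are definitionally equal but not at instance transparency, so the
instance `isCyclotomicExtension_K7` transports Mathlib's instance (by `convert` + `rfl`) to the structure
used by every statement of this annex. Not formalised: the identification of `Gal(K7/ℚ)` with `(ℤ/7)^×` beyond `nonempty_mulEquiv_zmod_six_K7`.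
-/

namespace Summit.Ventures.HodgeRepro2.CyclotomicSeven

open NumberField.ComplexEmbedding

section CMTypes

variable (K : Type*) [Field K] [NumberField K]

omit [NumberField K] in
/-- The complement of a CM type is its complex conjugate. -/
theorem compl_eq_image_conjugate {Φ : Set (K →+* ℂ)} (hΦ : IsCMType K Φ) :
    Φᶜ = conjugate '' Φ := by
  ext ψ
  constructor
  · intro hψ
    refine ⟨conjugate ψ, ?_, star_star ψ⟩
    rcases hΦ ψ with ⟨h1, _⟩ | ⟨h1, _⟩
    · exact absurd h1 hψ
    · exact h1
  · rintro ⟨φ, hφ, rfl⟩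
    intro h
    rcases hΦ φ with ⟨_, h2⟩ | ⟨_, h2⟩
    · exact h2 h
    · exact h2 hφ

/-- A CM type has exactly half of the complex embeddings: `2 · |Φ| = [K : ℚ]`. -/
theorem two_mul_ncard_cmType {Φ : Set (K →+* ℂ)} (hΦ : IsCMType K Φ) :
    2 * Φ.ncard = Module.finrank ℚ K := by
  have h1 : Φ.ncard + Φᶜ.ncard = Nat.card (K →+* ℂ) := Set.ncard_add_ncard_compl Φ
  rw [compl_eq_image_conjugate K hΦ,
    Set.ncard_image_of_injective _ (involutive_conjugate K).injective, Nat.card_eq_fintype_card,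
    NumberField.Embeddings.card K ℂ] at h1
  omega

/-- A CM type of a sextic CM field has three members. -/
theorem ncard_cmType_eq_three (h6 : Module.finrank ℚ K = 6) {Φ : Set (K →+* ℂ)}
    (hΦ : IsCMType K Φ) : Φ.ncard = 3 := by
  have h := two_mul_ncard_cmType K hΦ
  omega

variable [NumberField.IsCMField K]

/-- A sextic CM field carries a CM type indexed by `Fin 3`: the datum `τ` of `parityTetrahedron`. -/
theorem exists_cmType_triple (h6 : Module.finrank ℚ K = 6) :
    ∃ τ : Fin 3 → (K →+* ℂ), Function.Injective τ ∧ IsCMType K (Set.range τ) := by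
  obtain ⟨δ, hδ, hδ0⟩ := exists_imaginary_ne_zero K
  have hΦ := isCMType_cmTypeOfImaginary K hδ hδ0
  obtain ⟨x, y, z, hxy, hxz, hyz, hΦeq⟩ := Set.ncard_eq_three.1 (ncard_cmType_eq_three K h6 hΦ)
  refine ⟨![x, y, z], ?_, ?_⟩
  · intro i j hij
    fin_cases i <;> fin_cases j <;> simp_all
  · have h : Set.range ![x, y, z] = {x, y, z} := by
      ext w
      simp only [Matrix.range_cons, Matrix.range_empty, Set.union_empty, Set.singleton_union,
        Set.mem_insert_iff, Set.mem_singleton_iff]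
    rw [h, ← hΦeq]
    exact hΦ

/-- A sextic CM field carries a rank-four face: the parity tetrahedron of some CM type. -/
theorem exists_isWeilFace (h6 : Module.finrank ℚ K = 6) :
    ∃ τ : Fin 3 → (K →+* ℂ), IsWeilFace K (parityTetrahedron K τ) := by
  obtain ⟨τ, hinj, hτ⟩ := exists_cmType_triple K h6
  exact ⟨τ, isWeilFace_parityTetrahedron K τ hinj hτ⟩

end CMTypes

section Seven

/-- The seventh cyclotomic field `ℚ(ζ₇)`. -/
abbrev K7 : Type := CyclotomicField 7 ℚ

/-- `K7` is a cyclotomic extension of `ℚ` for the `ℚ`-algebra structure `DivisionRing.toRatAlgebra`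
(Mathlib's instance is stated for the splitting-field structure; the two are definitionally equal). -/
instance isCyclotomicExtension_K7 : IsCyclotomicExtension {7} ℚ K7 := by
  have h := CyclotomicField.isCyclotomicExtension 7 ℚ
  convert h
  all_goals rfl

/-- `K7/ℚ` is Galois. -/
instance isGalois_K7 : IsGalois ℚ K7 :=
  IsCyclotomicExtension.isGalois {7} ℚ K7

/-- `K7` is a CM field (a non-trivial cyclotomic field is CM). -/
instance isCMField_K7 : NumberField.IsCMField K7 :=
  IsCyclotomicExtension.Rat.isCMField K7 (S := {7}) ⟨7, Set.mem_singleton 7, by norm_num⟩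

/-- `[K7 : ℚ] = φ(7) = 6`. -/
theorem finrank_K7 : Module.finrank ℚ K7 = 6 := by
  rw [IsCyclotomicExtension.finrank K7 (Polynomial.cyclotomic.irreducible_rat (by norm_num : 0 < 7))]
  decide

/-- `K7` has six complex embeddings. -/
theorem card_embeddings_K7 : Fintype.card (K7 →+* ℂ) = 6 := by
  rw [NumberField.Embeddings.card, finrank_K7]

/-- A sextic Galois CM field exists. -/
theorem exists_sextic_galois_cmField :
    ∃ (K : Type) (_ : Field K) (_ : NumberField K),
      NumberField.IsCMField K ∧ IsGalois ℚ K ∧ Module.finrank ℚ K = 6 :=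
  ⟨K7, inferInstance, inferInstance, inferInstance, inferInstance, finrank_K7⟩

/-- `Gal(K7/ℚ)` is cyclic (TIER3 §5(i), now unconditional). -/
theorem isCyclic_gal_K7 : IsCyclic (K7 ≃ₐ[ℚ] K7) :=
  isCyclic_gal_of_finrank_six K7 finrank_K7

/-- `K7/ℚ` is abelian (Shimura 1998 §8.4 Ex. (1)'s hypothesis «F abelian over ℚ»). -/
theorem isAbelianGalois_K7 : IsAbelianGalois ℚ K7 :=
  isAbelianGalois_of_finrank_six K7 finrank_K7

/-- `Gal(K7/ℚ) ≅ ℤ/6`. -/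
theorem nonempty_mulEquiv_zmod_six_K7 : Nonempty (Multiplicative (ZMod 6) ≃* (K7 ≃ₐ[ℚ] K7)) :=
  nonempty_mulEquiv_zmod_six K7 finrank_K7

/-- `K7` carries a CM type indexed by `Fin 3`. -/
theorem exists_cmType_triple_K7 :
    ∃ τ : Fin 3 → (K7 →+* ℂ), Function.Injective τ ∧ IsCMType K7 (Set.range τ) :=
  exists_cmType_triple K7 finrank_K7

/-- `K7` carries a rank-four face (a parity tetrahedron): the objects of (S4) exist over `ℚ(ζ₇)`. -/
theorem exists_isWeilFace_K7 : ∃ τ : Fin 3 → (K7 →+* ℂ), IsWeilFace K7 (parityTetrahedron K7 τ) :=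
  exists_isWeilFace K7 finrank_K7

/-- Inversion maps the parity tetrahedron of every CM type of `K7` onto itself (§5(i), unconditional). -/
theorem range_inverseType_parityTetrahedron_K7 (τ₀ : K7 →+* ℂ) (τ : Fin 3 → K7 →+* ℂ)
    (hτ : IsCMType K7 (Set.range τ)) :
    (Set.range fun i => inverseType K7 τ₀ (parityTetrahedron K7 τ i)) =
      Set.range (parityTetrahedron K7 τ) :=
  range_inverseType_parityTetrahedron K7 finrank_K7 τ₀ τ hτ

open scoped Classical in
/-- Exactly one vertex of every parity tetrahedron of `K7` is non-primitive (§5(i), unconditional). -/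
theorem card_nonPrimitive_parityTetrahedron_K7 (τ₀ : K7 →+* ℂ) (τ : Fin 3 → K7 →+* ℂ)
    (hτ : IsCMType K7 (Set.range τ)) :
    ({i | ¬IsPrimitiveOn (⇑(galEmb K7 τ₀) ⁻¹' parityTetrahedron K7 τ i)} : Finset (Fin 4)).card = 1 :=
  card_nonPrimitive_parityTetrahedron K7 finrank_K7 τ₀ τ hτ

/-- Shimura-1979 Theorem 8.1 data with `m = 3` exist over `K7` for every distinguished embedding. -/
theorem exists_thm81Data_K7 (τ₁ : K7 →+* ℂ) : ∃ D : Thm81Data K7 2, D.τ = τ₁ :=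
  exists_thm81Data K7 τ₁

end Seven

end Summit.Ventures.HodgeRepro2.CyclotomicSeven
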